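import Summits.CriticalPhenomena.SAWScalingLimit.Theses.SAWMassiveIsingTilt
import Summits.CriticalPhenomena.SAWScalingLimit.Theorems.SAWMassiveIsingTiltDefs
import Literature.Probability.RandomPlanarGeometry.ConformalRestrictionHolds
import Literature.Probability.RandomPlanarGeometry.ConformalRestrictionLocal
import Literature.Probability.RandomPlanarGeometry.HullRestrictionSLEHolds
import Literature.Probability.RandomPlanarGeometry.CritPercSLESimplePathHolds
import Literature.Probability.RandomPlanarGeometry.SLEExistenceNeEightHolds
import Summits.CriticalPhenomena.SAWScalingLimit.Theorems.SAWMassiveIsingTiltHexEndpointApproxExists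
import HarnessLib

/-!
# Crux `MassiveWindowSLE` (stmt-CriticalPhenomena-7685), line `registered` (skeleton r5):
stub `stub_commonEndpointApprox` — common honeycomb endpoint approximations of a hull pair

Route `SAWMassiveIsingTilt` of `CriticalPhenomena/SAWScalingLimit`; lead prover c2 of the line
`registered` (skeleton r5). Stub C (lattice geometry) of the skeleton: for every Dobrushin domain
`D` and every HULL SUBDOMAIN `D'` of `D` (`MarkedDomain.IsHullSubdomain`: `D'.carrier ⊆ D.carrier`,
same marked points, the removed part away from them) there are honeycomb lattice endpoints
`a δ, b δ` which are an endpoint approximation (`SAW.IsEmbEndpointApprox hexGraph hexCenter`) of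
BOTH `(D; a, b)` and `(D'; a, b)`: joined in `Ω'_δ` and in `Ω_δ` for all small `δ > 0`, with mesh
points converging to the common marked points. The two passage stubs of the line (NoTouch, hull
restriction) compare the window laws of `D` and `D'` along such common endpoints.

Proof. Take ANY approximation `(a, b)` of `D'` (`HexEndpointApprox.exists_isEmbEndpointApprox`).
The two limit clauses transfer to `D` because the marked points agree. Reachability in `Ω_δ`: fix
a closed disc `K ⊆ D' ⊆ D`; by "the largest honeycomb mesh component of a Jordan domain is the
bulk" (`HexEndpointApprox.exists_forall_mem_hexMeshDomain_and_reachable`, applied to `D'` and to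
`D` with the same `K`), for small `δ` a honeycomb vertex `u` with mesh point in `K`
(`exists_hexVertex_dist_le_mul`) lies in both discrete domains, and `Ω'_δ`'s vertex set is one
mesh component of `D'`; an `Ω'_δ`-edge at `a δ` puts `a δ` in that vertex set, so `a δ` is joined
to `u` by a mesh path of `D'`, which is a mesh path of `D` (mesh vertices and mesh edges are
monotone in the domain) starting, read backwards, at `u ∈ Ω_δ`, hence an `Ω_δ`-path
(`HexEndpointApprox.reachable_embDomainGraph_of_walk`). Same for `b δ`.

References: H. Duminil-Copin, S. Smirnov, Ann. of Math. 175 (2012), §4 ("`a_δ`, `b_δ` the vertices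
of `Ω_δ` closest to `a`, `b`"); G. F. Lawler, O. Schramm, W. Werner, J. Amer. Math. Soc. 16 (2003),
§1 (hulls `A` bounded and bounded away from `0`).
-/

noncomputable section

namespace Summit.CriticalPhenomena.SAWScalingLimit.Theorems.MassiveWindowSLE.Birth

open scoped Topology
open Filter Set Metric
open Literature.Probability.LatticeModels Literature.Probability.RandomPlanarGeometry
open Literature.Probability.RandomPlanarGeometry.SAW

/-! ### Monotonicity of the mesh graph in the domain -/

/-- Mesh vertices are monotone in the domain: `Ω' ⊆ Ω` gives
`embMeshVertices emb Ω' δ ⊆ embMeshVertices emb Ω δ`. [folklore] -/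
private theorem cea_mem_embMeshVertices_mono {V : Type*} (emb : V → ℂ) {Ω Ω' : Set ℂ}
    (h : Ω' ⊆ Ω) {δ : ℝ} {v : V} (hv : v ∈ embMeshVertices emb Ω' δ) :
    v ∈ embMeshVertices emb Ω δ :=
  h (show (δ : ℂ) * emb v ∈ Ω' from hv)

/-- Mesh edges are monotone in the domain: a `G`-edge whose rescaled segment lies in `closure Ω'`
has it in `closure Ω ⊇ closure Ω'`. [folklore] -/
private theorem cea_embMeshGraph_adj_mono {V : Type*} (G : SimpleGraph V) (emb : V → ℂ)
    {Ω Ω' : Set ℂ} (h : Ω' ⊆ Ω) {δ : ℝ} {v w : V} (hvw : (embMeshGraph G emb Ω' δ).Adj v w) :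
    (embMeshGraph G emb Ω δ).Adj v w := by
  rw [embMeshGraph_adj_iff] at hvw ⊢
  exact ⟨hvw.1, hvw.2.trans (closure_mono h)⟩

/-- Reachability in the mesh graph on mesh vertices is monotone in the domain: a mesh path of
`Ω'` is a mesh path of `Ω ⊇ Ω'` (inclusion of induced subgraphs, by induction on the walk).
[folklore] -/
private theorem cea_reachable_embMeshVertexGraph_mono {V : Type*} {G : SimpleGraph V}
    {emb : V → ℂ} {Ω Ω' : Set ℂ} (h : Ω' ⊆ Ω) {δ : ℝ} {x y : embMeshVertices emb Ω' δ}
    (hxy : (embMeshVertexGraph G emb Ω' δ).Reachable x y) :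
    (embMeshVertexGraph G emb Ω δ).Reachable ⟨x.1, cea_mem_embMeshVertices_mono emb h x.2⟩
      ⟨y.1, cea_mem_embMeshVertices_mono emb h y.2⟩ := by
  obtain ⟨p⟩ := hxy
  induction p with
  | nil => rfl
  | @cons u v w hadj _ ih =>
    have hadj' : (embMeshGraph G emb Ω δ).Adj u v :=
      cea_embMeshGraph_adj_mono G emb h
        (by simpa only [SimpleGraph.comap_adj, Function.Embedding.subtype_apply] using hadj)
    have hadj'' : (embMeshVertexGraph G emb Ω δ).Adj
        ⟨u.1, cea_mem_embMeshVertices_mono emb h u.2⟩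
        ⟨v.1, cea_mem_embMeshVertices_mono emb h v.2⟩ := by
      simpa only [SimpleGraph.comap_adj, Function.Embedding.subtype_apply] using hadj'
    exact hadj''.reachable.trans ih

/-! ### Endpoints of `Ω_δ`-paths -/

/-- The starting point of a nontrivial `Ω_δ`-path is a vertex of `Ω_δ` (adjacency in
`embDomainGraph` carries membership of both ends in `embMeshDomain`). [folklore] -/
private theorem cea_mem_embMeshDomain_of_reachable_ne {V : Type*} {G : SimpleGraph V}
    {emb : V → ℂ} {Ω : Set ℂ} {δ : ℝ} {x y : V} (h : (embDomainGraph G emb Ω δ).Reachable x y)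
    (hne : x ≠ y) : x ∈ embMeshDomain G emb Ω δ := by
  obtain ⟨p⟩ := h
  cases p with
  | nil => exact absurd rfl hne
  | cons hadj _ => exact ((embDomainGraph_adj_iff G emb).1 hadj).2.1

/-- **Re-routing through the bulk.** Let `Ω' ⊆ Ω`, and suppose the discrete domain `Ω'_δ` is a
single mesh component of `Ω'` (the connectivity clause of
`HexEndpointApprox.exists_forall_mem_hexMeshDomain_and_reachable`). If `u` is a vertex of both
`Ω_δ` and `Ω'_δ` and `v` is a vertex of `Ω'_δ`, then `u` and `v` are joined in `Ω_δ`: a mesh path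
of `Ω'` from `u` to `v` is a mesh path of `Ω` starting in `Ω_δ`, hence an `Ω_δ`-path
(`HexEndpointApprox.reachable_embDomainGraph_of_walk`). [folklore] -/
private theorem cea_reachable_embDomainGraph_of_mem {Ω Ω' : Set ℂ} (hΩ : Ω' ⊆ Ω) {δ : ℝ}
    {u v : HexVertex}
    (hconn : ∀ x ∈ embMeshDomain hexGraph hexCenter Ω' δ,
      ∀ y ∈ embMeshDomain hexGraph hexCenter Ω' δ,
        ∃ (hx : x ∈ embMeshVertices hexCenter Ω' δ) (hy : y ∈ embMeshVertices hexCenter Ω' δ),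
          (embMeshVertexGraph hexGraph hexCenter Ω' δ).Reachable ⟨x, hx⟩ ⟨y, hy⟩)
    (hu : u ∈ embMeshDomain hexGraph hexCenter Ω δ)
    (hu' : u ∈ embMeshDomain hexGraph hexCenter Ω' δ)
    (hv' : v ∈ embMeshDomain hexGraph hexCenter Ω' δ) :
    (embDomainGraph hexGraph hexCenter Ω δ).Reachable u v := by
  obtain ⟨_, _, hr⟩ := hconn u hu' v hv'
  obtain ⟨q⟩ := cea_reachable_embMeshVertexGraph_mono (G := hexGraph) hΩ hr
  exact HexEndpointApprox.reachable_embDomainGraph_of_walk q hu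

/-! ### The stub -/

/-- **Stub C of skeleton r5 (crux `MassiveWindowSLE`, line `registered`): common endpoint
approximations of a hull pair.** For every Dobrushin domain `D` and hull subdomain `D'` there are
honeycomb endpoints `a δ, b δ` which are an endpoint approximation of BOTH `(D; a, b)` and
`(D'; a, b)`. Proof: any approximation of `D'` (`HexEndpointApprox.exists_isEmbEndpointApprox`)
works — the limits transfer since the marked points agree (`IsHullSubdomain.pt_zero_eq/pt_one_eq`),
and an `Ω'_δ`-connection is re-routed inside `Ω_δ` through a honeycomb vertex of a fixed closed
disc `K ⊆ D'`, which lies in both discrete domains for small `δ` because the largest honeycomb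
mesh component of a Jordan domain is the bulk
(`HexEndpointApprox.exists_forall_mem_hexMeshDomain_and_reachable` for `D'` and for `D`).
[folklore] -/
theorem stub_commonEndpointApprox :
    ∀ D D' : Literature.Probability.RandomPlanarGeometry.DobrushinDomain, D.IsHullSubdomain D' → ∃ a b : ℝ → Literature.Probability.LatticeModels.HexVertex, Literature.Probability.RandomPlanarGeometry.SAW.IsEmbEndpointApprox Literature.Probability.LatticeModels.hexGraph Literature.Probability.LatticeModels.hexCenter D a b ∧ Literature.Probability.RandomPlanarGeometry.SAW.IsEmbEndpointApprox Literature.Probability.LatticeModels.hexGraph Literature.Probability.LatticeModels.hexCenter D' a b := by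
  intro D D' hDD'
  obtain ⟨a, b, hab'⟩ := HexEndpointApprox.exists_isEmbEndpointApprox D'
  refine ⟨a, b, ⟨?_, ?_, ?_⟩, hab'⟩
  · -- reachability in `Ω_δ`, eventually: a closed disc `K ⊆ D' ⊆ D`
    obtain ⟨z₀, hz₀⟩ := D'.toJordanDomain.nonempty
    obtain ⟨ε, hε, hball⟩ := Metric.isOpen_iff.1 D'.isOpen z₀ hz₀
    have hK' : closedBall z₀ (ε / 2) ⊆ D'.carrier :=
      (closedBall_subset_ball (by linarith)).trans hball
    have hK : closedBall z₀ (ε / 2) ⊆ D.carrier := hK'.trans hDD'.carrier_subset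
    obtain ⟨δ₁, hδ₁, hgood'⟩ := HexEndpointApprox.exists_forall_mem_hexMeshDomain_and_reachable
      D'.toJordanDomain (isCompact_closedBall z₀ (ε / 2)) hK'
    obtain ⟨δ₂, hδ₂, hgood⟩ := HexEndpointApprox.exists_forall_mem_hexMeshDomain_and_reachable
      D.toJordanDomain (isCompact_closedBall z₀ (ε / 2)) hK
    have hpos : 0 < min (min δ₁ δ₂) (ε / 6) := lt_min (lt_min hδ₁ hδ₂) (by positivity)
    filter_upwards [hab'.reachable, Ioo_mem_nhdsGT hpos] with δ hreach hδ
    obtain ⟨hδ0, hδlt⟩ := hδ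
    have hδ₁' : δ < δ₁ := hδlt.trans_le ((min_le_left _ _).trans (min_le_left _ _))
    have hδ₂' : δ < δ₂ := hδlt.trans_le ((min_le_left _ _).trans (min_le_right _ _))
    have hδε : δ < ε / 6 := hδlt.trans_le (min_le_right _ _)
    -- a honeycomb vertex `u` with mesh point in `K`: in both discrete domains
    obtain ⟨u, hu⟩ := HexEndpointApprox.exists_hexVertex_dist_le_mul hδ0 z₀
    have huK : (δ : ℂ) * hexCenter u ∈ closedBall z₀ (ε / 2) :=
      mem_closedBall.2 (hu.trans (by linarith))
    have huD' : u ∈ embMeshDomain hexGraph hexCenter D'.carrier δ := (hgood' δ hδ0 hδ₁').1 u huK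
    have huD : u ∈ embMeshDomain hexGraph hexCenter D.carrier δ := (hgood δ hδ0 hδ₂').1 u huK
    rcases eq_or_ne (a δ) (b δ) with hab | hab
    · rw [hab]
    · -- `a δ`, `b δ` are vertices of `Ω'_δ`; re-route both to `u` inside `Ω_δ`
      have ha' : a δ ∈ embMeshDomain hexGraph hexCenter D'.carrier δ :=
        cea_mem_embMeshDomain_of_reachable_ne hreach hab
      have hb' : b δ ∈ embMeshDomain hexGraph hexCenter D'.carrier δ :=
        cea_mem_embMeshDomain_of_reachable_ne hreach.symm hab.symm
      have hconn := (hgood' δ hδ0 hδ₁').2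
      exact (cea_reachable_embDomainGraph_of_mem hDD'.carrier_subset hconn huD huD' ha').symm.trans
        (cea_reachable_embDomainGraph_of_mem hDD'.carrier_subset hconn huD huD' hb')
  · -- `δ · hexCenter (a δ) → D'.pt 0 = D.pt 0`
    rw [← hDD'.pt_zero_eq]
    exact hab'.tendsto_fst
  · -- `δ · hexCenter (b δ) → D'.pt 1 = D.pt 1`
    rw [← hDD'.pt_one_eq]
    exact hab'.tendsto_snd

end Summit.CriticalPhenomena.SAWScalingLimit.Theorems.MassiveWindowSLE.Birth
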